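import Literature.Geometry.Lorentzian.EndCompactification
import Literature.Topology.FourManifolds.GluedMetric
import Literature.Geometry.Lorentzian.PositiveMassConformal
import Literature.Geometry.Lorentzian.ModelData
import Literature.Geometry.Lorentzian.KelvinTransformAtInfinity
import Literature.Geometry.Lorentzian.HarmonicallyFlatPotential
import Literature.Geometry.Lorentzian.AsymptoticallyFlatCompleteness
import HarnessLib

/-!
# The Riemannian data on the compactified end `X ∪_e {∞}` (Bray 2001, proof of Thm. 8)

Bray, J. Differential Geom. 59 (2001) 177–267, §6, proof of Thm. 8: on a manifold with several
harmonically flat ends and a positive harmonic function `φ` tending to `0` in the end `e`,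
*"the metric `g̃ = φ⁴ḡ` in each end is conformal to a punctured ball with the conformal factor
being a bounded harmonic function to the fourth power in the punctured ball. Hence, by the
removable singularity theorem, this harmonic function can be extended to the whole ball, which
proves that the metric `g̃` can be extended smoothly over all of the points at infinity"*.

With the manifold `X ∪_e {∞}` (`AFEnd.Compactification`, `EndCompactification.lean`), the
Kelvin transform `W` of `V = 𝒰 · (φ ∘ Φ)` (`KelvinTransformAtInfinity.lean`: `W ∈ C^∞(ℝ³)`,
harmonic near `0`, `W(y) = |y|⁻¹ V(y/|y|²)` on the punctured ball) and the descent of metrics to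
open gluings (`GluedMetric.lean`), this file assembles the data:

* `conformallyFlatData U W` — the time-symmetric data `(W⁴ δ, 0)` on an open `U ⊆ ℝ³`
  (the cap chart of Bray's `g̃` near `∞`);
* `SmoothGlueData.exists_initialDataSet_of_glue_isometry` — time-symmetric Riemannian data on
  the two pieces of an open gluing for which the gluing map is an isometry descend to the glued
  manifold (corollary of `SmoothGlueData.exists_metric_of_glue_isometry`);
* `AFEnd.mfderiv_capMap_apply` — the differential of the gluing map `q ↦ ι(chart q)` is
  `dι ∘ dchart`; `AFEnd.hCoeff_coord_mfderiv₂` — the chart components evaluate the metric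
  (bilinear form of `hCoeff_coord_mfderiv`);
* `AFEnd.capGlue_isometry` — **the gluing map is an isometry** between `φ⁴ h` on the far
  region and `W⁴ δ` on the punctured cap: in the chart, `φ⁴ h = φ⁴ 𝒰⁴ δ = V⁴ δ`, and
  `ι^*(W⁴ δ_y) = W(ι x)⁴ |x|⁻⁴ δ_x = V(x)⁴ δ_x` because `dι` is `|x|⁻²` times an isometry
  (`inner_fderiv_inversion_zero_one`) and `W(ι x) = |x| V(x)`;
* `AFEnd.exists_compactifiedData` — **the data `(X ∪_e {∞}, g̃)`**: for a harmonically flat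
  end `e` with factor `𝒰`, a smooth positive `φ`, `h`-harmonic far out in `e` and tending to `0`
  there, with positive monopole coefficient of `V`, there are `R'`, the Kelvin transform `W`
  (smooth, positive and harmonic on the cap) and time-symmetric data `D̃` on
  `e.Compactification hR'` with `incl^* h̃ = φ⁴ h` and `cap^* h̃ = W⁴ δ`.

The remaining properties of `(X ∪ {∞}, g̃)` used by Bray (one end fewer, completeness,
`R ≥ 0`, the mass `m̄ - 2c` in another harmonically flat end) are left to the sequel.

## References

* H. L. Bray, *Proof of the Riemannian Penrose inequality using the positive mass theorem*,
  J. Differential Geom. 59 (2001) 177–267, §6, proof of Thm. 8. [BrayRPI2001]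
* G. B. Folland, *Introduction to Partial Differential Equations*, 2nd ed. (1995), §2.I,
  Prop. (2.74) and the computation `g_ij = |y|⁻⁴ δ_ij` before (2.72). [Folland2020]
* B. O'Neill, *Semi-Riemannian Geometry* (1983), Ch. 3, pp. 90–91. [ONeill1983]
-/

noncomputable section

open Set Function Metric TopologicalSpace EuclideanGeometry Filter Topology Bundle Bornology
open scoped Manifold ContDiff Topology RealInnerProductSpace

namespace Literature.Geometry.Lorentzian

open Literature.Topology.FourManifolds Literature.Geometry.Manifold

/-! ### Conformally flat time-symmetric data on an open subset of `ℝ³` -/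

/-- **Flat time-symmetric data `(δ, 0)`** on an open subset `U ⊆ ℝ³` (the pattern of
`Minkowski.flatMetric` / `trivialData` on the whole slice). O'Neill 1983, Ch. 3, p. 55.
[cite: ONeill1983, Ch. 3 p. 55] -/
def flatData (U : Opens E3) : InitialDataSet (𝓡 3) U where
  h :=
    { inner := fun _ ↦ (innerSL ℝ (E := E3) : E3 →L[ℝ] E3 →L[ℝ] ℝ)
      symm := fun _ v w ↦ real_inner_comm (F := E3) w v
      pos := fun _ _ hv ↦ (real_inner_self_pos (F := E3)).2 hv
      isVonNBounded := fun y ↦ (riemannianMetricVectorSpace E3).isVonNBounded y.1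
      contMDiff := OpensSection.contMDiff_bilinSection U _ contMDiff_const }
  k _ := 0
  k_symm _ _ _ := rfl
  contMDiff_k := contMDiff_zero_bilinSection

/-- The metric of the flat data is `δ`. [folklore] -/
@[simp]
theorem flatData_h_inner (U : Opens E3) (y : U) :
    (flatData U).h.inner y = (innerSL ℝ (E := E3) : E3 →L[ℝ] E3 →L[ℝ] ℝ) := rfl

/-- **Conformally flat time-symmetric data `(W⁴ δ, 0)`** on an open subset `U ⊆ ℝ³`, for a
smooth `W : ℝ³ → ℝ` positive on `U` (the cap chart `g̃ = W⁴ δ_y` of Bray's compactified metric,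
proof of Thm. 8; the conformally flat ansatz of Schoen–Yau 1979, §2): the conformal data
`(flatData U).conformal W`. [cite: BrayRPI2001, §6 proof of Thm. 8] -/
def conformallyFlatData (U : Opens E3) (W : E3 → ℝ) (hW : ContDiff ℝ ∞ W)
    (hpos : ∀ y : U, 0 < W y) : InitialDataSet (𝓡 3) U :=
  (flatData U).conformal (fun y : U ↦ W y) (hW.contMDiff.comp contMDiff_subtype_val) hpos

/-- The metric of the conformally flat data: `(W⁴ δ)_y (v, w) = W(y)⁴ ⟨v, w⟩`. [folklore] -/
@[simp]
theorem conformallyFlatData_h_inner (U : Opens E3) (W : E3 → ℝ) (hW : ContDiff ℝ ∞ W)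
    (hpos : ∀ y : U, 0 < W y) (y : U) (v w : TangentSpace (𝓡 3) y) :
    (conformallyFlatData U W hW hpos).h.inner y v w = W y ^ 4 * @inner ℝ E3 _ v w := rfl

/-- The conformally flat data are time-symmetric (`k = 0`). [folklore] -/
theorem conformallyFlatData_isTimeSymmetric (U : Opens E3) (W : E3 → ℝ) (hW : ContDiff ℝ ∞ W)
    (hpos : ∀ y : U, 0 < W y) : (conformallyFlatData U W hW hpos).IsTimeSymmetric := fun _ ↦ rfl

/-! ### Time-symmetric data descend to an open gluing -/

section Glue

universe uA uB

variable {E_A H_A E_B H_B : Type*}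
  [NormedAddCommGroup E_A] [NormedSpace ℝ E_A] [TopologicalSpace H_A]
  [NormedAddCommGroup E_B] [NormedSpace ℝ E_B] [TopologicalSpace H_B]
  {I_A : ModelWithCorners ℝ E_A H_A} {I_B : ModelWithCorners ℝ E_B H_B}
  {A : Type uA} [TopologicalSpace A] [ChartedSpace H_A A]
  {B : Type uB} [TopologicalSpace B] [ChartedSpace H_B B]
  {E_P : Type*} [NormedAddCommGroup E_P] [NormedSpace ℝ E_P]
  [I_A.Boundaryless] [I_B.Boundaryless] [IsManifold I_A ∞ A] [IsManifold I_B ∞ B]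
  [FiniteDimensional ℝ E_A] [FiniteDimensional ℝ E_B] [FiniteDimensional ℝ E_P]

set_option synthInstance.maxHeartbeats 400000 in
/-- **Time-symmetric Riemannian data descend to an open gluing** when the gluing map is an
isometry: corollary of `SmoothGlueData.exists_metric_of_glue_isometry` and
`SmoothGlueData.isRiemannian_of_glue` (the glued metric is Riemannian, smooth, with
`inl^* h = h_A`, `inr^* h = h_B`; `k = 0`). O'Neill 1983, Ch. 3, pp. 90–91; the data on Bray's
`M ∪ {∞_k}` (proof of Thm. 8) and on the reflection double (proof of Thm. 9).
[cite: ONeill1983, Ch. 3, pp. 90–91] -/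
theorem _root_.Literature.Topology.FourManifolds.SmoothGlueData.exists_initialDataSet_of_glue_isometry
    (d : SmoothGlueData I_A I_B A B E_P) (DA : InitialDataSet I_A A) (DB : InitialDataSet I_B B)
    (hiso : ∀ a ∈ d.glue.source, ∀ v w : TangentSpace I_A a,
      DB.h.inner (d.glue a) (mfderiv I_A I_B d.glue a v) (mfderiv I_A I_B d.glue a w) =
        DA.h.inner a v w) :
    ∃ D : InitialDataSet 𝓘(ℝ, E_P) d.Glued, D.IsTimeSymmetric ∧
      (∀ (a : A) (v w : TangentSpace I_A a),
        D.h.inner (d.inl a) (mfderiv I_A 𝓘(ℝ, E_P) d.inl a v) (mfderiv I_A 𝓘(ℝ, E_P) d.inl a w) =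
          DA.h.inner a v w) ∧
      (∀ (b : B) (v w : TangentSpace I_B b),
        D.h.inner (d.inr b) (mfderiv I_B 𝓘(ℝ, E_P) d.inr b v) (mfderiv I_B 𝓘(ℝ, E_P) d.inr b w) =
          DB.h.inner b v w) := by
  obtain ⟨g, hgA, hgB⟩ := d.exists_metric_of_glue_isometry DA.metric DB.metric hiso
  have hRiem : g.IsRiemannian :=
    d.isRiemannian_of_glue DA.metric DB.metric g hgA hgB DA.isRiemannian_metric DB.isRiemannian_metric
  let hg : ContMDiffRiemannianMetric 𝓘(ℝ, E_P) ∞ E_P (TangentSpace 𝓘(ℝ, E_P) : d.Glued → Type _) :=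
    { inner := g.val,
      symm := g.symm,
      pos := fun x v hv ↦ hRiem x v hv,
      isVonNBounded := fun x ↦
        PseudoRiemannianMetric.IsSpacelikeImmersion.isVonNBounded_setOf_lt_one_of_pos
          (V := E_P) (g.val x) fun v hv ↦ hRiem x v hv,
      contMDiff := g.contMDiff }
  let D : InitialDataSet 𝓘(ℝ, E_P) d.Glued :=
    { h := hg,
      k := fun _ ↦ 0,
      k_symm := fun _ _ _ ↦ rfl,
      contMDiff_k := Bundle.contMDiff_zeroSection ℝ
        (fun y : d.Glued ↦ TangentSpace 𝓘(ℝ, E_P) y →L[ℝ] TangentSpace 𝓘(ℝ, E_P) y →L[ℝ] ℝ) }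
  exact ⟨D, fun _ ↦ rfl, hgA, hgB⟩

end Glue

/-! ### The gluing map of the compactification is an isometry `φ⁴ h ≅ W⁴ δ` -/

namespace AFEnd

variable {X : Type} [TopologicalSpace X] [ChartedSpace E3 X] [IsManifold (𝓡 3) ∞ X]
  (e : AFEnd X) {R' : ℝ}

omit [IsManifold (𝓡 3) ∞ X] in
/-- **The differential of the gluing map**: for `q ∈ far R'` and `v ∈ T_q X`,
`d(capMap)_q v = dι_{chart q} (dchart_q v)` as a vector of `ℝ³` (the cap is an open submanifold
of `ℝ³`, `capMap = ι ∘ chart` near `q`). [folklore] -/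
theorem mfderiv_capMap_apply (hR' : e.R ≤ R') {q : X} (hq : q ∈ e.far R')
    (v : TangentSpace (𝓡 3) q) :
    (mfderiv (𝓡 3) (𝓡 3) (e.capMap hR') q v : E3) =
      fderiv ℝ (inversion (0 : E3) 1) (e.coord q) (mfderiv (𝓡 3) 𝓘(ℝ, E3) e.coord q v) := by
  have hqU : q ∈ e.U := e.mem_U_of_mem_far hq
  have hne : e.coord q ≠ 0 := e.coord_ne_zero_of_mem_far hR' hq
  have hcap : MDifferentiableAt (𝓡 3) (𝓡 3) (e.capMap hR') q :=
    ((e.contMDiffOn_capGlue hR').contMDiffAt ((e.isOpen_far R').mem_nhds hq)).mdifferentiableAt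
      (by simp)
  have h1 : mfderiv (𝓡 3) 𝓘(ℝ, E3) (Subtype.val ∘ e.capMap hR') q v =
      mfderiv (𝓡 3) (𝓡 3) (e.capMap hR') q v := by
    rw [mfderiv_comp q (OpenSubmanifold.mdifferentiableAt_subtype_val _) hcap,
      OpenSubmanifold.mfderiv_subtype_val]
    rfl
  have hev : (Subtype.val ∘ e.capMap hR') =ᶠ[𝓝 q] (inversion (0 : E3) 1 ∘ e.coord) := by
    filter_upwards [(e.isOpen_far R').mem_nhds hq] with q' hq'
    exact e.coe_capMap_of_mem hR' hq'
  have hι : MDifferentiableAt 𝓘(ℝ, E3) 𝓘(ℝ, E3) (inversion (0 : E3) 1) (e.coord q) :=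
    ((contDiffAt_inversion_zero_one (n := 1) hne).differentiableAt (by simp)).mdifferentiableAt
  have hcoord : MDifferentiableAt (𝓡 3) 𝓘(ℝ, E3) e.coord q :=
    (e.contMDiffAt_coord hqU).mdifferentiableAt (by simp)
  have h2 : mfderiv (𝓡 3) 𝓘(ℝ, E3) (Subtype.val ∘ e.capMap hR') q v =
      fderiv ℝ (inversion (0 : E3) 1) (e.coord q) (mfderiv (𝓡 3) 𝓘(ℝ, E3) e.coord q v) := by
    rw [hev.mfderiv_eq, mfderiv_comp q hι hcoord, ← mfderiv_eq_fderiv]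
    rfl
  rw [← h1]
  exact h2

/-- **The chart components evaluate the metric, bilinear form** of
`hCoeff_chart_apply_mfderiv`: `h_ij(chart q) (dchart v) (dchart w) = h_q(v, w)` (the defining
property of `h_ij = (Φ^* h)_ij`, Bartnik 1986, (1.3), read backwards through `dΦ ∘ dchart = id`).
[cite: Bartnik1986, (1.3)] -/
theorem hCoeff_chart_apply_mfderiv₂ (D : InitialDataSet (𝓡 3) X) (q : e.U)
    (v w : TangentSpace (𝓡 3) q) :
    hCoeff e D (e.chart q : E3) (mfderiv (𝓡 3) (𝓡 3) e.chart q v)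
      (mfderiv (𝓡 3) (𝓡 3) e.chart q w) = D.h.inner (q : X) v w := by
  rw [hCoeff_coe]
  have key : ∀ (a : X) (_ : a = (q : X)) (v' : E3) (_ : v' = v) (w' : E3) (_ : w' = w),
      D.h.inner a v' w' = D.h.inner (q : X) v w := by
    rintro a rfl v' rfl w' rfl
    rfl
  exact key _ (e.dataChart_chart q) _ (e.mfderiv_dataChart_mfderiv_chart q v) _
    (e.mfderiv_dataChart_mfderiv_chart q w)

/-- The same through the global coordinate function `coord`:
`h_ij(coord q) (dcoord v) (dcoord w) = h_q(v, w)` for `q` in the end. [cite: Bartnik1986, (1.3)] -/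
theorem hCoeff_coord_mfderiv₂ (D : InitialDataSet (𝓡 3) X) (q : e.U)
    (v w : TangentSpace (𝓡 3) (q : X)) :
    hCoeff e D (e.coord q) (mfderiv (𝓡 3) 𝓘(ℝ, E3) e.coord q v)
      (mfderiv (𝓡 3) 𝓘(ℝ, E3) e.coord q w) = D.metric.val (q : X) v w := by
  have h := e.hCoeff_chart_apply_mfderiv₂ D q v w
  rw [← e.mfderiv_coord_comp_val q v, ← e.mfderiv_coord_comp_val q w, ← e.coord_of_mem q.2] at h
  exact h

/-- **The gluing map of the compactification is an isometry `φ⁴ h ≅ W⁴ δ`.** Let the end `e`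
be harmonically flat with factor `𝒰` beyond `R₁ ≤ R'`, `φ > 0` smooth on `X`, and `W` smooth,
positive on the cap, with `W(ι x) = |x| 𝒰(x) φ(Φ x)` for `|x| > R'` (the Kelvin transform of
`V = 𝒰 · (φ ∘ Φ)`). Then for `q ∈ far R'` and `v, w ∈ T_q X`,
`(W⁴ δ)(d capMap v, d capMap w) = φ(q)⁴ h_q(v, w)`: in the chart `h = 𝒰⁴ δ`,
`d capMap = dι ∘ dchart`, and `⟨dι a, dι b⟩ = |x|⁻⁴ ⟨a, b⟩` (Folland's `g_ij = |y|⁻⁴ δ_ij`;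
Bray 2001, proof of Thm. 8: "`g̃ = φ⁴ ḡ` in each end is conformal to a punctured ball").
[cite: BrayRPI2001, §6 proof of Thm. 8] -/
theorem capGlue_isometry (hR' : e.R ≤ R') (D : InitialDataSet (𝓡 3) X) [D.metric.HasLeviCivita]
    {R₁ : ℝ} {𝒰 : E3 → ℝ} (hHF : e.IsHarmonicallyFlatWith D R₁ 𝒰) (hR₁ : R₁ ≤ R')
    (φ : X → ℝ) (hφ : ContMDiff (𝓡 3) 𝓘(ℝ) ∞ φ) (hφpos : ∀ x, 0 < φ x)
    (W : E3 → ℝ) (hW : ContDiff ℝ ∞ W) (hWpos : ∀ y : capBall R'⁻¹, 0 < W y)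
    (hWeq : ∀ x : E3, R' < ‖x‖ → W (inversion (0 : E3) 1 x) = ‖x‖ * (𝒰 x * endValue e φ x)) :
    ∀ q ∈ (e.capGlue hR').source, ∀ v w : TangentSpace (𝓡 3) q,
      (conformallyFlatData (capBall R'⁻¹) W hW hWpos).h.inner (e.capGlue hR' q)
          (mfderiv (𝓡 3) (𝓡 3) (e.capGlue hR') q v) (mfderiv (𝓡 3) (𝓡 3) (e.capGlue hR') q w) =
        (D.conformal φ hφ hφpos).h.inner q v w := by
  intro q hq v w
  have hq' : q ∈ e.far R' := hq
  have hqU : q ∈ e.U := e.mem_U_of_mem_far hq'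
  have hxR' : R' < ‖e.coord q‖ := e.lt_norm_coord_of_mem_far hq'
  have hxR₁ : R₁ < ‖e.coord q‖ := lt_of_le_of_lt hR₁ hxR'
  have hxR : e.R < ‖e.coord q‖ := lt_of_le_of_lt hR' hxR'
  have hx0 : e.coord q ≠ 0 := e.coord_ne_zero_of_mem_far hR' hq'
  have hxn : ‖e.coord q‖ ≠ 0 := norm_ne_zero_iff.2 hx0
  -- the point and the vectors in the cap chart
  have hy : ((e.capMap hR' q : capBall R'⁻¹) : E3) = inversion (0 : E3) 1 (e.coord q) :=
    e.coe_capMap_of_mem hR' hq'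
  have hdv := e.mfderiv_capMap_apply hR' hq' v
  have hdw := e.mfderiv_capMap_apply hR' hq' w
  -- the metric in the chart of the end: `h = 𝒰⁴ δ`
  have hmetric : hCoeff e D (e.coord q) (mfderiv (𝓡 3) 𝓘(ℝ, E3) e.coord q v)
      (mfderiv (𝓡 3) 𝓘(ℝ, E3) e.coord q w) = D.metric.val q v w :=
    e.hCoeff_coord_mfderiv₂ D ⟨q, hqU⟩ v w
  have hHFx : hCoeff e D (e.coord q) (mfderiv (𝓡 3) 𝓘(ℝ, E3) e.coord q v)
      (mfderiv (𝓡 3) 𝓘(ℝ, E3) e.coord q w) =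
      𝒰 (e.coord q) ^ 4 * @inner ℝ E3 _ (mfderiv (𝓡 3) 𝓘(ℝ, E3) e.coord q v)
        (mfderiv (𝓡 3) 𝓘(ℝ, E3) e.coord q w) := by
    rw [(hHF.2.1 (e.coord q) hxR₁).2.1]
    rfl
  have hendv : endValue e φ (e.coord q) = φ q := by
    rw [endValue_of_lt e φ hxR, e.dataChart_coord hqU]
  change W ((e.capMap hR' q : capBall R'⁻¹) : E3) ^ 4 *
      @inner ℝ E3 _ (mfderiv (𝓡 3) (𝓡 3) (e.capMap hR') q v)
        (mfderiv (𝓡 3) (𝓡 3) (e.capMap hR') q w) = φ q ^ 4 * D.metric.val q v w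
  rw [hy, hdv, hdw, inner_fderiv_inversion_zero_one hx0, hWeq (e.coord q) hxR', ← hmetric, hHFx,
    hendv]
  field_simp

/-- **The Riemannian data on `X ∪_e {∞}`** (Bray 2001, proof of Thm. 8: `g̃ = φ⁴ḡ` extends
smoothly over the point at infinity of a harmonically flat end in which `φ → 0`). Let `e` be a
harmonically flat end of `(X, h)` with factor `𝒰` (`h = 𝒰⁴δ` beyond `R₁`, `𝒰` harmonic,
`𝒰 → a > 0`), `φ > 0` smooth on `X`, `h`-harmonic beyond `R₂` in the end and tending to `0`
there, and assume the monopole coefficient of the flat-harmonic function `V = 𝒰 · (φ ∘ Φ)` is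
positive. Then for a suitable `R' ≥ R` there are the Kelvin transform `W` of `V` — `C^∞` on
`ℝ³`, positive and harmonic on the cap `B(0, 1/R')`, `W(ι x) = |x| V(x)` for `|x| > R'` — and
time-symmetric data `D̃` on `e.Compactification hR'` whose metric pulls back to `φ⁴ h` under
`incl` and to `W⁴ δ` under the cap chart. [cite: BrayRPI2001, §6 proof of Thm. 8] -/
theorem exists_compactifiedData (D : InitialDataSet (𝓡 3) X) [D.metric.HasLeviCivita]
    {R₁ : ℝ} {𝒰 : E3 → ℝ} (hHF : e.IsHarmonicallyFlatWith D R₁ 𝒰)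
    (φ : X → ℝ) (hφ : ContMDiff (𝓡 3) 𝓘(ℝ) ∞ φ) (hφpos : ∀ x, 0 < φ x)
    {R₂ : ℝ} (hΔ : ∀ y : exteriorRegion e.R, R₂ < ‖(y : E3)‖ →
      D.metric.dalembertian φ (e.dataChart y) = 0)
    (hφ0 : TendstoAtEnd e φ 0)
    (hb : ∀ b : ℝ, HasHarmonicExpansion (fun x ↦ 𝒰 x * endValue e φ x) 0 b → 0 < b) :
    ∃ (R' : ℝ) (hR' : e.R ≤ R') (W : E3 → ℝ) (D' : InitialDataSet (𝓡 3) (e.Compactification hR')),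
      ContDiff ℝ ∞ W ∧ (∀ y : capBall R'⁻¹, 0 < W y) ∧
      R₁ < R' ∧ InnerProductSpace.HarmonicOnNhd W (ball (0 : E3) R'⁻¹) ∧
      (∀ x : E3, R' < ‖x‖ → W (inversion (0 : E3) 1 x) = ‖x‖ * (𝒰 x * endValue e φ x)) ∧
      D'.IsTimeSymmetric ∧
      (∀ (q : X) (v w : TangentSpace (𝓡 3) q),
        D'.h.inner (Compactification.incl e hR' q)
            (mfderiv (𝓡 3) (𝓡 3) (Compactification.incl e hR') q v)
            (mfderiv (𝓡 3) (𝓡 3) (Compactification.incl e hR') q w) =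
          φ q ^ 4 * D.h.inner q v w) ∧
      (∀ (y : capBall R'⁻¹) (u u' : TangentSpace (𝓡 3) y),
        D'.h.inner (Compactification.cap e hR' y)
            (mfderiv (𝓡 3) (𝓡 3) (Compactification.cap e hR') y u)
            (mfderiv (𝓡 3) (𝓡 3) (Compactification.cap e hR') y u') =
          W y ^ 4 * @inner ℝ E3 _ u u') := by
  -- the flat-harmonic function `V = 𝒰 · (φ ∘ Φ)` and its Kelvin transform
  set V : E3 → ℝ := fun x ↦ 𝒰 x * endValue e φ x with hV_def
  have h2le : ((2 : ℕ) : ℕ∞ω) ≤ ∞ := WithTop.coe_le_coe.mpr le_top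
  have hφ2 : ∀ y : exteriorRegion e.R, R₂ < ‖(y : E3)‖ →
      ContMDiffAt (𝓡 3) 𝓘(ℝ, ℝ) 2 φ (e.dataChart y) := fun y _ ↦ (hφ _).of_le h2le
  have hVh : InnerProductSpace.HarmonicOnNhd V {x : E3 | max R₁ R₂ < ‖x‖} := fun z hz ↦
    hHF.harmonicAt_factor_mul_endValue hφ2 hΔ hz
  obtain ⟨a, ha, h𝒰a⟩ := hHF.2.2.2
  have hV0 : Tendsto V (cobounded E3) (𝓝 0) := by
    have := h𝒰a.mul hφ0
    rwa [mul_zero] at this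
  obtain ⟨W, ρ, b, hW, hρ, hWeq, hWharm, hexpV, hW0⟩ :=
    exists_contDiff_kelvinTransform_of_harmonicOnNhd (max R₁ R₂) V hVh hV0
  have hb0 : 0 < b := hb b hexpV
  -- the scale `R'`
  set R' : ℝ := max e.R (max R₁ R₂) + ρ⁻¹ + 1 with hR'_def
  have hρi : 0 < ρ⁻¹ := inv_pos.2 hρ
  have hR' : e.R ≤ R' := by
    have := le_max_left e.R (max R₁ R₂)
    rw [hR'_def]; linarith
  have hR₁ : R₁ < R' := by
    have := (le_max_left R₁ R₂).trans (le_max_right e.R (max R₁ R₂))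
    rw [hR'_def]; linarith
  have hR0 : 0 < R' := e.R_pos.trans_le hR'
  have hρR : ρ⁻¹ < R' := by
    have h1 : e.R ≤ max e.R (max R₁ R₂) := le_max_left _ _
    have h2 := e.R_pos
    rw [hR'_def]; linarith
  have hR'ρ : R'⁻¹ < ρ := by
    have := inv_strictAnti₀ hρi hρR
    rwa [inv_inv] at this
  -- `W(ι x) = |x| V(x)` for `|x| > R'`
  have hWι : ∀ x : E3, R' < ‖x‖ → W (inversion (0 : E3) 1 x) = ‖x‖ * (𝒰 x * endValue e φ x) := by
    intro x hx
    have hx0 : x ≠ 0 := fun h ↦ by rw [h, norm_zero] at hx; exact lt_irrefl _ (hR0.trans hx)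
    have hy0 : inversion (0 : E3) 1 x ≠ 0 := inversion_zero_one_ne_zero hx0
    have hyn : ‖inversion (0 : E3) 1 x‖ = ‖x‖⁻¹ := norm_inversion_zero_one x
    have hyρ : ‖inversion (0 : E3) 1 x‖ < ρ := by
      rw [hyn]
      exact (inv_strictAnti₀ hR0 hx).trans hR'ρ
    rw [hWeq _ hy0 hyρ, ← inversion_zero_one_eq, inversion_zero_one_inversion, hyn, inv_inv]
  -- positivity of `W` on the cap
  have hWpos : ∀ y : capBall R'⁻¹, 0 < W y := by
    intro y
    have hyR : ‖(y : E3)‖ < R'⁻¹ := mem_capBall.1 y.2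
    by_cases hy0 : (y : E3) = 0
    · rw [hy0, hW0]
      exact hb0
    · have hyρ : ‖(y : E3)‖ < ρ := hyR.trans hR'ρ
      rw [hWeq _ hy0 hyρ, ← inversion_zero_one_eq]
      have hz : R' < ‖inversion (0 : E3) 1 (y : E3)‖ := lt_norm_inversion_of_norm_lt hy0 hyR
      have hzR : e.R < ‖inversion (0 : E3) 1 (y : E3)‖ := lt_of_le_of_lt hR' hz
      have hz₁ : R₁ < ‖inversion (0 : E3) 1 (y : E3)‖ := hR₁.trans hz
      refine mul_pos (inv_pos.2 (norm_pos_iff.2 hy0)) (mul_pos (hHF.2.1 _ hz₁).1 ?_)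
      rw [endValue_of_lt e φ hzR]
      exact hφpos _
  -- the glued data
  have hiso := e.capGlue_isometry hR' D hHF hR₁.le φ hφ hφpos W hW hWpos hWι
  obtain ⟨D', hts, hA, hB⟩ :=
    (e.capGlueData hR').exists_initialDataSet_of_glue_isometry (D.conformal φ hφ hφpos)
      (conformallyFlatData (capBall R'⁻¹) W hW hWpos) hiso
  have hball : InnerProductSpace.HarmonicOnNhd W (ball (0 : E3) R'⁻¹) :=
    hWharm.mono (ball_subset_ball hR'ρ.le)
  exact ⟨R', hR', W, D', hW, hWpos, hR₁, hball, hWι, hts, fun q v w ↦ hA q v w,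
    fun y u u' ↦ hB y u u'⟩

end AFEnd

end Literature.Geometry.Lorentzian

end
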